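import Mathlib
import HarnessLib
import Literature.Analysis.FluidPDE.SteadyStrainedNS
import Literature.Analysis.FluidPDE.ParabolicHarnackDriftRefutation

/-!
# Crux `PoloidalWindowRigidity` (K2, stmt-NavierStokesRegularity-19708) — negative side:
# three crossed oblique suction layers — an entire steady POLOIDAL Navier–Stokes flow with CONSTANT Clebsch slope `1/2`

Negative-side support (refuter seat ns-regularity-refuter1 g3, cell ns-regularity-ideate; D-0081 §C), companion of
`…Negative.ProportionalShearTight` and of the sequel `…Negative.CrossedSuctionLayersSymmetry` (this flow's vorticity has
NO continuous Euclidean symmetry — kill test K-a of the K2 line `lrc-jet`; the verdict for the line is recorded there).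

THE FLOW (`ν = 1`; `x₀, x₁` horizontal, `x₂` vertical; amplitudes `a, b, c`; `E₁ = e^{x₀+x₂}`, `E₂ = e^{x₁−x₂}`,
`E₃ = e^{x₂−x₀}`):
  `v = ( −(a/2)E₁ + (c/2)E₃ ,  4 − (b/2)E₂ ,  2 + (a/2)E₁ + (c/2)E₃ − (b/2)E₂ )`,
  `p = −(ab/4)E₁E₂ − (bc/4)E₂E₃ − (ac/2)E₁E₃ = −(ab/4)e^{x₀+x₁} − (bc/4)e^{x₁−x₀} − (ac/2)e^{2x₂}`.

* `isSteadyClassicalNS_crossField` / `isClassicalNSSolutionOn_crossField`: for ALL `a b c` a smooth (entire) steady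
  solution of Navier–Stokes with viscosity `1` and no force — `(v·∇)v = Δv − ∇p`, `div v = 0` — in the tree's
  `IsSteadyClassicalNS` / `IsClassicalNSSolutionOn univ` sense (`Δv = 2(v − (0,4,2))`, `laplacian_crossField`).
* `curl_crossField`: `ω = curl v = (−bE₂, −aE₁ + cE₃, 0)` — poloidal, nowhere zero for `b ≠ 0`.
* `proportionalShear_crossField` / `clebschSlope_crossField`: `∂₂v_h = −∇_h v₂` (proportional shear `μ = −1`) and
  `∂₀v₂ = −½ω₁`, `∂₁v₂ = ½ω₀` — constant Clebsch slope `Λ ≡ 1/2 ∉ {0,1}` — in the exact hypothesis shapes `hshear` /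
  `hslope` of K2-p1's `…PoloidalWindowDoorPoloidalWindowRigidityProportionalShear`.

The flow is unbounded (exponential growth): NOT a profile of the crux class `𝔓(C)`; the generating mechanism (oblique
asymptotic-suction layers [cite: Drazin2002, Exercise 8.27] and their exact superposition rule) is described in the
sequel.  WHAT THIS IS NOT: not a statement about Navier–Stokes regularity and not a refutation of any registered
item — an explicit exact solution filed as negative knowledge for the crux. [folklore]
-/

noncomputable section
set_option linter.dupNamespace false

namespace Summit.NavierStokesRegularity.NavierStokesRegularity.Theorems.PoloidalWindowRigidity.Negative

open Set Function Filter Topology Metric Real InnerProductSpace WithLp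
open scoped Laplacian RealInnerProductSpace ContDiff
open Literature.Analysis Literature.Analysis.FluidPDE

/-- Local notation for physical space `ℝ³ = EuclideanSpace ℝ (Fin 3)`. -/
local notation "ℝ³" => EuclideanSpace ℝ (Fin 3)
/-- Local notation for the standard basis vectors. -/
local notation "𝐞" j => EuclideanSpace.single (j : Fin 3) (1 : ℝ)

namespace CrossedLayers
/-- First layer `E₁(x) = exp(x₀ + x₂)` (wave covector `k₁ = (1,0,1)`). [folklore] -/
def E₁ (x : ℝ³) : ℝ := exp (x 0 + x 2)

/-- Second layer `E₂(x) = exp(x₁ − x₂)` (wave covector `k₂ = (0,1,−1)`). [folklore] -/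
def E₂ (x : ℝ³) : ℝ := exp (x 1 - x 2)

/-- Third layer `E₃(x) = exp(x₂ − x₀)` (wave covector `k₃ = (−1,0,1)`). [folklore] -/
def E₃ (x : ℝ³) : ℝ := exp (x 2 - x 0)

/-- The layers are positive. [folklore] -/
theorem E₁_pos (x : ℝ³) : 0 < E₁ x := exp_pos _
/-- The layers are positive. [folklore] -/
theorem E₂_pos (x : ℝ³) : 0 < E₂ x := exp_pos _
/-- The layers are positive. [folklore] -/
theorem E₃_pos (x : ℝ³) : 0 < E₃ x := exp_pos _

/-- The coordinate `x_j` has derivative `dx_j`. [folklore] -/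
private theorem hasFDerivAt_coord (j : Fin 3) (x : ℝ³) :
    HasFDerivAt (fun y : ℝ³ => y j) (EuclideanSpace.proj j : ℝ³ →L[ℝ] ℝ) x :=
  (EuclideanSpace.proj j : ℝ³ →L[ℝ] ℝ).hasFDerivAt

/-- The covector `dx₀ + dx₂` of the first layer. [folklore] -/
def ℓ₁ : ℝ³ →L[ℝ] ℝ := (EuclideanSpace.proj 0 : ℝ³ →L[ℝ] ℝ) + (EuclideanSpace.proj 2 : ℝ³ →L[ℝ] ℝ)
/-- The covector `dx₁ − dx₂` of the second layer. [folklore] -/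
def ℓ₂ : ℝ³ →L[ℝ] ℝ := (EuclideanSpace.proj 1 : ℝ³ →L[ℝ] ℝ) - (EuclideanSpace.proj 2 : ℝ³ →L[ℝ] ℝ)
/-- The covector `dx₂ − dx₀` of the third layer. [folklore] -/
def ℓ₃ : ℝ³ →L[ℝ] ℝ := (EuclideanSpace.proj 2 : ℝ³ →L[ℝ] ℝ) - (EuclideanSpace.proj 0 : ℝ³ →L[ℝ] ℝ)

/-- `ℓ₁ h = h₀ + h₂`. [folklore] -/
@[simp] theorem ℓ₁_apply (h : ℝ³) : ℓ₁ h = h 0 + h 2 := rfl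
/-- `ℓ₂ h = h₁ − h₂`. [folklore] -/
@[simp] theorem ℓ₂_apply (h : ℝ³) : ℓ₂ h = h 1 - h 2 := rfl
/-- `ℓ₃ h = h₂ − h₀`. [folklore] -/
@[simp] theorem ℓ₃_apply (h : ℝ³) : ℓ₃ h = h 2 - h 0 := rfl

/-- `DE₁ = E₁ ℓ₁`. [folklore] -/
theorem hasFDerivAt_E₁ (x : ℝ³) : HasFDerivAt E₁ (E₁ x • ℓ₁) x :=
  ((hasFDerivAt_coord 0 x).add (hasFDerivAt_coord 2 x)).exp
/-- `DE₂ = E₂ ℓ₂`. [folklore] -/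
theorem hasFDerivAt_E₂ (x : ℝ³) : HasFDerivAt E₂ (E₂ x • ℓ₂) x :=
  ((hasFDerivAt_coord 1 x).sub (hasFDerivAt_coord 2 x)).exp
/-- `DE₃ = E₃ ℓ₃`. [folklore] -/
theorem hasFDerivAt_E₃ (x : ℝ³) : HasFDerivAt E₃ (E₃ x • ℓ₃) x :=
  ((hasFDerivAt_coord 2 x).sub (hasFDerivAt_coord 0 x)).exp

/-- The layers are smooth. [folklore] -/
theorem contDiff_E₁ {n : WithTop ℕ∞} : ContDiff ℝ n E₁ :=
  ((EuclideanSpace.proj (0 : Fin 3) : ℝ³ →L[ℝ] ℝ).contDiff.add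
    (EuclideanSpace.proj (2 : Fin 3) : ℝ³ →L[ℝ] ℝ).contDiff).exp
/-- The layers are smooth. [folklore] -/
theorem contDiff_E₂ {n : WithTop ℕ∞} : ContDiff ℝ n E₂ :=
  ((EuclideanSpace.proj (1 : Fin 3) : ℝ³ →L[ℝ] ℝ).contDiff.sub
    (EuclideanSpace.proj (2 : Fin 3) : ℝ³ →L[ℝ] ℝ).contDiff).exp
/-- The layers are smooth. [folklore] -/
theorem contDiff_E₃ {n : WithTop ℕ∞} : ContDiff ℝ n E₃ :=
  ((EuclideanSpace.proj (2 : Fin 3) : ℝ³ →L[ℝ] ℝ).contDiff.sub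
    (EuclideanSpace.proj (0 : Fin 3) : ℝ³ →L[ℝ] ℝ).contDiff).exp

/-- **Three crossed oblique suction layers** (amplitudes `a, b, c`, viscosity `1`, slope `1/2`): the drift `(0,4,2)`
plus the layers `A_j â_j e^{k_j·x}`, `k_j ∈ {(1,0,1), (0,1,−1), (−1,0,1)}`, `â_j = ½(−(k_j)_h, (k_j)₂)`. [folklore] -/
def crossField (a b c : ℝ) (x : ℝ³) : ℝ³ :=
  toLp 2 ![-(a / 2) * E₁ x + (c / 2) * E₃ x, 4 - (b / 2) * E₂ x,
    2 + (a / 2) * E₁ x + (c / 2) * E₃ x - (b / 2) * E₂ x]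

/-- Component `v₀`. [folklore] -/
@[simp] theorem crossField_apply_zero (a b c : ℝ) (x : ℝ³) :
    crossField a b c x 0 = -(a / 2) * E₁ x + (c / 2) * E₃ x := rfl
/-- Component `v₁`. [folklore] -/
@[simp] theorem crossField_apply_one (a b c : ℝ) (x : ℝ³) :
    crossField a b c x 1 = 4 - (b / 2) * E₂ x := rfl
/-- Component `v₂`. [folklore] -/
@[simp] theorem crossField_apply_two (a b c : ℝ) (x : ℝ³) :
    crossField a b c x 2 = 2 + (a / 2) * E₁ x + (c / 2) * E₃ x - (b / 2) * E₂ x := rfl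

/-- The Jacobian `jac x j i = ∂ⱼ vᵢ(x)`. [folklore] -/
def jac (a b c : ℝ) (x : ℝ³) : Fin 3 → Fin 3 → ℝ :=
  ![![-(a / 2) * E₁ x - (c / 2) * E₃ x, 0, (a / 2) * E₁ x - (c / 2) * E₃ x],
    ![0, -(b / 2) * E₂ x, -(b / 2) * E₂ x],
    ![-(a / 2) * E₁ x + (c / 2) * E₃ x, (b / 2) * E₂ x, (a / 2) * E₁ x + (c / 2) * E₃ x + (b / 2) * E₂ x]]

variable (a b c : ℝ)

/-- The field as a combination of the standard basis vectors. [folklore] -/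
theorem crossField_eq (y : ℝ³) : crossField a b c y =
    (-(a / 2) * E₁ y + (c / 2) * E₃ y) • (𝐞 0) + (4 - (b / 2) * E₂ y) • (𝐞 1) +
      (2 + (a / 2) * E₁ y + (c / 2) * E₃ y - (b / 2) * E₂ y) • (𝐞 2) := by
  ext i; fin_cases i <;> simp [crossField]

/-- The derivative of the field: `D v(x) = Σᵢ (D vᵢ(x)) ⊗ eᵢ`. [folklore] -/
theorem hasFDerivAt_crossField (x : ℝ³) :
    HasFDerivAt (crossField a b c)
      (((-(a / 2) * E₁ x) • ℓ₁ + ((c / 2) * E₃ x) • ℓ₃).smulRight (𝐞 0) +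
        ((-(b / 2) * E₂ x) • ℓ₂).smulRight (𝐞 1) +
        (((a / 2) * E₁ x) • ℓ₁ + ((c / 2) * E₃ x) • ℓ₃ + (-(b / 2) * E₂ x) • ℓ₂).smulRight (𝐞 2)) x := by
  have e : crossField a b c = fun y => (-(a / 2) * E₁ y + (c / 2) * E₃ y) • (𝐞 0) +
      (4 - (b / 2) * E₂ y) • (𝐞 1) + (2 + (a / 2) * E₁ y + (c / 2) * E₃ y - (b / 2) * E₂ y) • (𝐞 2) :=
    funext (crossField_eq a b c)
  rw [e]
  have h0 := (((hasFDerivAt_E₁ x).const_mul (-(a / 2))).add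
    ((hasFDerivAt_E₃ x).const_mul (c / 2))).smul_const (𝐞 0)
  have h1 := (((hasFDerivAt_E₂ x).const_mul (b / 2)).const_sub 4).smul_const (𝐞 1)
  have h2 := (((((hasFDerivAt_E₁ x).const_mul (a / 2)).const_add 2).add
    ((hasFDerivAt_E₃ x).const_mul (c / 2))).sub ((hasFDerivAt_E₂ x).const_mul (b / 2))).smul_const (𝐞 2)
  refine ((h0.add h1).add h2).congr_fderiv ?_
  ext h i
  fin_cases i
  · simp [smul_smul]
  · simp [smul_smul]
  · simp [smul_smul]; ring

/-- The field is smooth. [folklore] -/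
theorem contDiff_crossField {n : WithTop ℕ∞} : ContDiff ℝ n (crossField a b c) := by
  have e : crossField a b c = fun y => (-(a / 2) * E₁ y + (c / 2) * E₃ y) • (𝐞 0) +
      (4 - (b / 2) * E₂ y) • (𝐞 1) + (2 + (a / 2) * E₁ y + (c / 2) * E₃ y - (b / 2) * E₂ y) • (𝐞 2) :=
    funext (crossField_eq a b c)
  rw [e]
  exact ((((contDiff_const.mul contDiff_E₁).add (contDiff_const.mul contDiff_E₃)).smul contDiff_const).add
    ((contDiff_const.sub (contDiff_const.mul contDiff_E₂)).smul contDiff_const)).add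
    ((((contDiff_const.add (contDiff_const.mul contDiff_E₁)).add (contDiff_const.mul contDiff_E₃)).sub
      (contDiff_const.mul contDiff_E₂)).smul contDiff_const)

/-- The directional derivative in coordinates: `(Dv(x)h)ᵢ = Σⱼ hⱼ ∂ⱼvᵢ`. [folklore] -/
theorem fderiv_crossField_apply (x h : ℝ³) (i : Fin 3) :
    fderiv ℝ (crossField a b c) x h i =
      h 0 * jac a b c x 0 i + h 1 * jac a b c x 1 i + h 2 * jac a b c x 2 i := by
  rw [(hasFDerivAt_crossField a b c x).fderiv]
  fin_cases i
  · simp [jac]; ring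
  · simp [jac]; ring
  · simp [jac]; ring

/-- Partial derivatives: `∂ⱼvᵢ = jac j i`. [folklore] -/
theorem fderiv_crossField_single (x : ℝ³) (j i : Fin 3) :
    fderiv ℝ (crossField a b c) x (𝐞 j) i = jac a b c x j i := by
  rw [fderiv_crossField_apply]
  fin_cases j <;> simp

/-- **The field is divergence free.** [folklore] -/
theorem isDivFree_crossField : VectorCalculus.IsDivFree (crossField a b c) := fun x => by
  rw [divergence_eq_sum_inner_fderiv (EuclideanSpace.basisFun (Fin 3) ℝ)]
  simp only [Fin.sum_univ_three, EuclideanSpace.basisFun_apply, EuclideanSpace.inner_single_left, map_one,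
    one_mul, fderiv_crossField_single]
  simp [jac]; ring

/-- The vorticity field `ω = (−b E₂, −a E₁ + c E₃, 0)`. [folklore] -/
def vort (x : ℝ³) : ℝ³ := toLp 2 ![-b * E₂ x, -a * E₁ x + c * E₃ x, 0]

/-- Component `ω₀`. [folklore] -/
@[simp] theorem vort_apply_zero (x : ℝ³) : vort a b c x 0 = -b * E₂ x := rfl
/-- Component `ω₁`. [folklore] -/
@[simp] theorem vort_apply_one (x : ℝ³) : vort a b c x 1 = -a * E₁ x + c * E₃ x := rfl
/-- Component `ω₂ = 0`. [folklore] -/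
@[simp] theorem vort_apply_two (x : ℝ³) : vort a b c x 2 = 0 := rfl

/-- **The vorticity**: `curl v = (−b E₂, −a E₁ + c E₃, 0)` — horizontal (poloidal). [folklore] -/
theorem curl_crossField (x : ℝ³) : curl (crossField a b c) x = vort a b c x := by
  ext i
  fin_cases i <;> simp [curl, fderiv_crossField_single, jac, vort] <;> ring

/-- `curl v = ω` as functions. [folklore] -/
theorem curl_crossField_eq : curl (crossField a b c) = vort a b c := funext (curl_crossField a b c)

/-- **Poloidal**: the vertical vorticity vanishes identically. [folklore] -/
theorem curl_crossField_apply_two (x : ℝ³) : curl (crossField a b c) x 2 = 0 := by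
  rw [curl_crossField]; rfl

/-- The vorticity vanishes nowhere as soon as `b ≠ 0`. [folklore] -/
theorem curl_crossField_ne_zero (hb : b ≠ 0) (x : ℝ³) : curl (crossField a b c) x ≠ 0 := by
  intro h
  have h0 := congrArg (fun w : ℝ³ => w 0) h
  simp only [curl_crossField, vort_apply_zero, PiLp.zero_apply] at h0
  exact (mul_ne_zero (neg_ne_zero.mpr hb) (E₂_pos x).ne') h0

/-- **Proportional shear with `μ = −1`** (K2-p1's shape `∂₂v₀ = μ ∂₀v₂ ∧ ∂₂v₁ = μ ∂₁v₂`). [folklore] -/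
theorem proportionalShear_crossField (y : ℝ³) :
    fderiv ℝ (crossField a b c) y (EuclideanSpace.single 2 (1 : ℝ)) 0 =
        (-1) * fderiv ℝ (crossField a b c) y (EuclideanSpace.single 0 (1 : ℝ)) 2 ∧
      fderiv ℝ (crossField a b c) y (EuclideanSpace.single 2 (1 : ℝ)) 1 =
        (-1) * fderiv ℝ (crossField a b c) y (EuclideanSpace.single 1 (1 : ℝ)) 2 := by
  refine ⟨?_, ?_⟩ <;> simp [fderiv_crossField_single, jac]
  ring

/-- **Constant Clebsch slope `λ = 1/2`** (K2-p1's shape `∂₀v₂ = −λ ω₁ ∧ ∂₁v₂ = λ ω₀`). [folklore] -/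
theorem clebschSlope_crossField (y : ℝ³) :
    fderiv ℝ (crossField a b c) y (EuclideanSpace.single 0 (1 : ℝ)) 2 = -((1 / 2) * curl (crossField a b c) y 1) ∧
      fderiv ℝ (crossField a b c) y (EuclideanSpace.single 1 (1 : ℝ)) 2 = (1 / 2) * curl (crossField a b c) y 0 := by
  refine ⟨?_, ?_⟩ <;> simp [fderiv_crossField_single, jac, curl_crossField] <;> ring

/-- Components of the vector Laplacian are the Laplacians of the components. [folklore] -/
private theorem laplacian_apply_coord {v : ℝ³ → ℝ³} {x : ℝ³} (hv : ContDiffAt ℝ 2 v x) (j : Fin 3) :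
    (Δ v x) j = Δ (fun y => v y j) x := by
  have key := hv.laplacian_CLM_comp_left (l := (EuclideanSpace.proj j : ℝ³ →L[ℝ] ℝ))
  have hl : (fun y => v y j) = (EuclideanSpace.proj j : ℝ³ →L[ℝ] ℝ) ∘ v := rfl
  rw [hl, key]
  rfl

/-- The covector of the first layer as a vector: `k₁ = (1,0,1)`. [folklore] -/
def k₁ : ℝ³ := toLp 2 ![1, 0, 1]
/-- `k₂ = (0,1,−1)`. [folklore] -/
def k₂ : ℝ³ := toLp 2 ![0, 1, -1]
/-- `k₃ = (−1,0,1)`. [folklore] -/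
def k₃ : ℝ³ := toLp 2 ![-1, 0, 1]

/-- `⟪k₁, y⟫ = y₀ + y₂`. [folklore] -/
private theorem inner_k₁ (y : ℝ³) : ⟪k₁, y⟫ = y 0 + y 2 := by
  simp [k₁, PiLp.inner_apply, Fin.sum_univ_three]
/-- `⟪k₂, y⟫ = y₁ − y₂`. [folklore] -/
private theorem inner_k₂ (y : ℝ³) : ⟪k₂, y⟫ = y 1 - y 2 := by
  simp [k₂, PiLp.inner_apply, Fin.sum_univ_three]; ring
/-- `⟪k₃, y⟫ = y₂ − y₀`. [folklore] -/
private theorem inner_k₃ (y : ℝ³) : ⟪k₃, y⟫ = y 2 - y 0 := by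
  simp [k₃, PiLp.inner_apply, Fin.sum_univ_three]; ring
/-- `|k₁|² = 2`. [folklore] -/
private theorem norm_sq_k₁ : ‖k₁‖ ^ 2 = 2 := by
  rw [← real_inner_self_eq_norm_sq, inner_k₁]; simp [k₁]; norm_num
/-- `|k₂|² = 2`. [folklore] -/
private theorem norm_sq_k₂ : ‖k₂‖ ^ 2 = 2 := by
  rw [← real_inner_self_eq_norm_sq, inner_k₂]; simp [k₂]; norm_num
/-- `|k₃|² = 2`. [folklore] -/
private theorem norm_sq_k₃ : ‖k₃‖ ^ 2 = 2 := by
  rw [← real_inner_self_eq_norm_sq, inner_k₃]; simp [k₃]; norm_num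

/-- `E₁` as an exponential plane wave. [folklore] -/
private theorem E₁_eq_planeWave : E₁ = fun y : ℝ³ => exp 0 * exp (1 * ⟪k₁, y⟫) := by
  funext y; simp [E₁, inner_k₁]
/-- `E₂` as an exponential plane wave. [folklore] -/
private theorem E₂_eq_planeWave : E₂ = fun y : ℝ³ => exp 0 * exp (1 * ⟪k₂, y⟫) := by
  funext y; simp [E₂, inner_k₂]
/-- `E₃` as an exponential plane wave. [folklore] -/
private theorem E₃_eq_planeWave : E₃ = fun y : ℝ³ => exp 0 * exp (1 * ⟪k₃, y⟫) := by
  funext y; simp [E₃, inner_k₃]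

/-- `ΔE₁ = |k₁|² E₁ = 2E₁`. [folklore] -/
theorem laplacian_E₁ (x : ℝ³) : Δ E₁ x = 2 * E₁ x := by
  rw [E₁_eq_planeWave, laplacian_exp_mul_exp_inner, norm_sq_k₁]; ring
/-- `ΔE₂ = 2E₂`. [folklore] -/
theorem laplacian_E₂ (x : ℝ³) : Δ E₂ x = 2 * E₂ x := by
  rw [E₂_eq_planeWave, laplacian_exp_mul_exp_inner, norm_sq_k₂]; ring
/-- `ΔE₃ = 2E₃`. [folklore] -/
theorem laplacian_E₃ (x : ℝ³) : Δ E₃ x = 2 * E₃ x := by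
  rw [E₃_eq_planeWave, laplacian_exp_mul_exp_inner, norm_sq_k₃]; ring

/-- **The Laplacian of the field**: `Δv = 2(v − (0,4,2)) = (−aE₁ + cE₃, −bE₂, aE₁ + cE₃ − bE₂)` (every layer has
`|k_j|² = 2`). [folklore] -/
theorem laplacian_crossField (x : ℝ³) : Δ (crossField a b c) x =
    toLp 2 ![-a * E₁ x + c * E₃ x, -b * E₂ x, a * E₁ x + c * E₃ x - b * E₂ x] := by
  have h2 : ContDiffAt ℝ 2 (crossField a b c) x := (contDiff_crossField a b c).contDiffAt
  have c1 : ∀ k : ℝ, ContDiffAt ℝ 2 (k • E₁) x := fun k => contDiff_E₁.contDiffAt.const_smul k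
  have c2 : ∀ k : ℝ, ContDiffAt ℝ 2 (k • E₂) x := fun k => contDiff_E₂.contDiffAt.const_smul k
  have c3 : ∀ k : ℝ, ContDiffAt ℝ 2 (k • E₃) x := fun k => contDiff_E₃.contDiffAt.const_smul k
  have k4 : ContDiffAt ℝ 2 (fun _ : ℝ³ => (4 : ℝ)) x := contDiffAt_const
  have k2 : ContDiffAt ℝ 2 (fun _ : ℝ³ => (2 : ℝ)) x := contDiffAt_const
  have l0 : (Δ (crossField a b c) x) 0 = -a * E₁ x + c * E₃ x := by
    rw [laplacian_apply_coord h2 0]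
    have e : (fun y => crossField a b c y 0) = (-(a / 2)) • E₁ + (c / 2) • E₃ := by
      funext y; simp [smul_eq_mul]
    rw [e, (c1 _).laplacian_add (c3 _), laplacian_smul _ contDiff_E₁.contDiffAt,
      laplacian_smul _ contDiff_E₃.contDiffAt, laplacian_E₁, laplacian_E₃]
    simp only [smul_eq_mul]; ring
  have l1 : (Δ (crossField a b c) x) 1 = -b * E₂ x := by
    rw [laplacian_apply_coord h2 1]
    have e : (fun y => crossField a b c y 1) = (fun _ => (4 : ℝ)) - (b / 2) • E₂ := by
      funext y; simp [smul_eq_mul]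
    rw [e, k4.laplacian_sub (c2 _), laplacian_smul _ contDiff_E₂.contDiffAt, laplacian_E₂, laplacian_const]
    simp only [Pi.zero_apply, smul_eq_mul]; ring
  have l2 : (Δ (crossField a b c) x) 2 = a * E₁ x + c * E₃ x - b * E₂ x := by
    rw [laplacian_apply_coord h2 2]
    have e : (fun y => crossField a b c y 2) =
        (fun _ => (2 : ℝ)) + (a / 2) • E₁ + (c / 2) • E₃ - (b / 2) • E₂ := by
      funext y; simp [smul_eq_mul]
    have s1 : ContDiffAt ℝ 2 ((fun _ : ℝ³ => (2 : ℝ)) + (a / 2) • E₁) x := k2.add (c1 _)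
    have s2 : ContDiffAt ℝ 2 ((fun _ : ℝ³ => (2 : ℝ)) + (a / 2) • E₁ + (c / 2) • E₃) x := s1.add (c3 _)
    rw [e, s2.laplacian_sub (c2 _), s1.laplacian_add (c3 _),
      k2.laplacian_add (c1 _), laplacian_smul _ contDiff_E₁.contDiffAt,
      laplacian_smul _ contDiff_E₂.contDiffAt, laplacian_smul _ contDiff_E₃.contDiffAt, laplacian_E₁,
      laplacian_E₂, laplacian_E₃, laplacian_const]
    simp only [Pi.zero_apply, smul_eq_mul]; ring
  ext j
  fin_cases j
  · simpa using l0
  · simpa using l1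
  · simpa using l2

/-- The pressure `p = −(ab/4)E₁E₂ − (bc/4)E₂E₃ − (ac/2)E₁E₃ = −(ab/4)e^{x₀+x₁} − (bc/4)e^{x₁−x₀} − (ac/2)e^{2x₂}`
(minus the potentials of the three pairwise layer interactions). [folklore] -/
def crossPressure (x : ℝ³) : ℝ :=
  -(a * b / 4) * (E₁ x * E₂ x) - (b * c / 4) * (E₂ x * E₃ x) - (a * c / 2) * (E₁ x * E₃ x)

/-- The pressure gradient `∇p`. [folklore] -/
def crossPressureGrad (x : ℝ³) : ℝ³ :=
  toLp 2 ![-(a * b / 4) * (E₁ x * E₂ x) + (b * c / 4) * (E₂ x * E₃ x),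
    -(a * b / 4) * (E₁ x * E₂ x) - (b * c / 4) * (E₂ x * E₃ x),
    -(a * c) * (E₁ x * E₃ x)]

/-- The pressure is smooth. [folklore] -/
theorem contDiff_crossPressure {n : WithTop ℕ∞} : ContDiff ℝ n (crossPressure a b c) :=
  ((contDiff_const.mul (contDiff_E₁.mul contDiff_E₂)).sub (contDiff_const.mul (contDiff_E₂.mul contDiff_E₃))).sub
    (contDiff_const.mul (contDiff_E₁.mul contDiff_E₃))

/-- The derivative of the pressure. [folklore] -/
theorem hasFDerivAt_crossPressure (x : ℝ³) : HasFDerivAt (crossPressure a b c)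
    ((-(a * b / 4)) • (E₁ x • (E₂ x • ℓ₂) + E₂ x • (E₁ x • ℓ₁)) -
      (b * c / 4) • (E₂ x • (E₃ x • ℓ₃) + E₃ x • (E₂ x • ℓ₂)) -
      (a * c / 2) • (E₁ x • (E₃ x • ℓ₃) + E₃ x • (E₁ x • ℓ₁))) x :=
  ((((hasFDerivAt_E₁ x).mul (hasFDerivAt_E₂ x)).const_smul (-(a * b / 4))).sub
    (((hasFDerivAt_E₂ x).mul (hasFDerivAt_E₃ x)).const_smul (b * c / 4))).sub
    (((hasFDerivAt_E₁ x).mul (hasFDerivAt_E₃ x)).const_smul (a * c / 2))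

/-- **The pressure gradient.** [folklore] -/
theorem hasGradientAt_crossPressure (x : ℝ³) :
    HasGradientAt (crossPressure a b c) (crossPressureGrad a b c x) x := by
  rw [hasGradientAt_iff_hasFDerivAt]
  refine (hasFDerivAt_crossPressure a b c x).congr_fderiv ?_
  ext h
  rw [toDual_apply_apply]
  simp only [crossPressureGrad, PiLp.inner_apply, Fin.sum_univ_three, RCLike.inner_apply, conj_trivial]
  simp
  ring

/-- `∇p = crossPressureGrad`. [folklore] -/
theorem gradient_crossPressure (x : ℝ³) : gradient (crossPressure a b c) x = crossPressureGrad a b c x :=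
  (hasGradientAt_crossPressure a b c x).gradient

/-- **Three crossed oblique suction layers solve the steady Navier–Stokes equations** (viscosity `1`, no force):
`(v·∇)v = Δv − ∇p`, `div v = 0`, with `v = crossField a b c`, `p = crossPressure a b c`, for ALL amplitudes
`a, b, c`. Mechanism: each layer `A â e^{k·x}` (`â ⊥ k`) is an exact «oblique asymptotic-suction layer» once the
drift `c₀ = (0,4,2)` satisfies `c₀·k = |k|²`; the pairwise interaction terms `(a_i·k_j)a_j + (a_j·k_i)a_i` are
parallel to `k_i + k_j`, i.e. pressure gradients. [folklore] -/
theorem isSteadyClassicalNS_crossField : IsSteadyClassicalNS 1 0 (crossField a b c) (crossPressure a b c) where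
  smooth_velocity := contDiff_crossField a b c
  smooth_pressure := contDiff_crossPressure a b c
  momentum x := by
    rw [convect_apply, laplacian_crossField, gradient_crossPressure, one_smul, Pi.zero_apply, add_zero]
    ext i
    fin_cases i
    · simp [fderiv_crossField_apply, jac, crossPressureGrad]; ring
    · simp [fderiv_crossField_apply, jac, crossPressureGrad]; ring
    · simp [fderiv_crossField_apply, jac, crossPressureGrad]; ring
  divFree := isDivFree_crossField a b c

/-- The same flow as a (time-independent) classical Navier–Stokes solution on the whole time axis, in the tree's
`IsClassicalNSSolutionOn` sense. [folklore] -/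
theorem isClassicalNSSolutionOn_crossField :
    IsClassicalNSSolutionOn (univ : Set ℝ) 1 (fun _ => (0 : ℝ³ → ℝ³)) (fun _ => crossField a b c)
      (fun _ => crossPressure a b c) :=
  isSteadyClassicalNS_iff_const.mp (isSteadyClassicalNS_crossField a b c)

end CrossedLayers

end Summit.NavierStokesRegularity.NavierStokesRegularity.Theorems.PoloidalWindowRigidity.Negative
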